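import Literature.MathematicalPhysics.QuantumFieldTheory.Balaban1983to89.B9CubeBondWeights
import Literature.MathematicalPhysics.QuantumFieldTheory.Balaban1983to89.Node00.OpsYDeltaA
import Literature.MathematicalPhysics.QuantumFieldTheory.Balaban1983to89.B6Ineq288MultiLevelTorusL0

/-!
# `Balaban1983to89.B9CubeLettersBondOpsL0` — THE CUBE-LOCAL BOND-SECTOR LETTERS `Q_□(U)`, `Q*_□(U)`, `a_□`, `Q′_□(U)`, `Q′*_□(U)`,
# `(Q′G′_□²Q′*)(U)`, `R_□(U)`, `C_□(U) = (Q′(U)G′_□²(U)Q′*(U))⁻¹`, `Δ_{a,□}(U)`, `G_□(U) = Δ_{a,□}(U)⁻¹` OF [B9] SECT. C p. 409 AS FUNCTIONS OF `U`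
# ON def-Y's CARRIERS — `Node00.OpsYDeltaA` §2–§5 RE-INSTANTIATED at the cube sequence (`cubeFamY`, `domCube`, `wCubeBond`, `GpCubeY`); the block
# letters act on the CUBE SEQUENCE's blocks `BlkCubeY i q` (lead g29 RULING #5 (P4) = (α): block-type-parametric slot), the coarse-bond letters on its
# index bonds `IBondCubeY i q`, `Δ_{a,□}(U)` and `G_□(U)` on the member's fine-bond carrier `FBondY i` (sub-row G-B9-LETTERS, module M5.1c PART 2 (P4), file 1)

FRAMING (verbatim cell line):
statement-level skeleton of published theorems with citation tags; proofs where landed; nothing here is a claim about the Yang–Mills mass gap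

Sources under audit (cell lit-balaban): T. Bałaban, *Propagators for lattice gauge theories in a background field*, Commun. Math. Phys. **99**
(1985) 389–434 [`Balaban1985BackgroundPropagators`, "B9"], (3.12)–(3.13) p. 392, (3.14) p. 393, (3.21) p. 394, (3.25) p. 394, (3.26)–(3.27) p. 395, (3.48) p. 398, Sect. C
p. 408–409 («G′_□(U), C_□(U) = (Q′(U)G′_□²(U)Q′*(U))⁻¹, G_□(U)»), (3.87) p. 409; T. Bałaban, *Propagators and renormalization transformations for
lattice gauge theories. II*, Commun. Math. Phys. **96** (1984) 223–250 [`Balaban1984PropagatorsII`, "[4]"], (2.14)–(2.20) pp. 225–226, (2.69),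
(2.86)–(2.87) pp. 235–238.  Unit `lit-balaban-r05` (r05 gen 77).

## WHAT IS PRINTED (verbatim up to notation)

[B9] p. 409 l. 1–5: «The operators constructed for this sequence, which we denote by G′_□(U), C_□(U) = (Q′(U)G′_□²(U)Q′*(U))⁻¹, G_□(U), satisfy all
the inequalities of Theorems 3.1–3.3»; (3.25) p. 394, (3.26)–(3.27) p. 395: «R(U) = I − G′(U)Q′*(U)(Q′(U)G′²(U)Q′*(U))⁻¹Q′(U)G′(U) …
Δ_a(U) = Δ(U) + D_UR(U)D*_U + Q*(U)aQ(U) (3.26) … G(U) = Δ_a(U)⁻¹ (3.27)»; (3.87): «C₀ = Σ_□ h_□C_□h_□, G₀ = Σ_□ h_□G_□h_□».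

## WHAT THIS FILE PROVIDES (definitions with bodies, the SAME formulas as `Node00.OpsYDeltaA` with the cube sequence's data; kernel-checked API)

§1 carriers `BlkCubeY i q := ↥(bset (cubeFamY i q).toDomains)` (blocks of the cube sequence), `IBondCubeY i q := BondIdx (domCube i q)` (its index
bonds — the same pairs (level, coarse bond) as `IBondY i`, the cube sequence's membership).  §2 flat kernels: `qKc ∕ qsKc` (matrices of `QE ∕ QsE
(domCube i q)`), `aKc` (of `aE (domCube i q) (wCubeBond i q)`), `qpKc ∕ qpsKc := …TorusL0.QM ∕ QsM (cubeFamY i q)`, the block weights `cWtCubeY`;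
transporters `qTc` (def-Y's formula verbatim), `qpTc` (transport to the corner of the CUBE block).  §3 letters: `QCubeY ∕ QsCubeY ∕ aCubeY ∕ QpCubeY ∕
QpsCubeY`, ★ `XCubeY parS U := Q′_□(U)G′_□(U)G′_□(U)Q′*_□(U)` with `G′_□ := GpCubeY i q parS`, `XinvCubeY := Ring.inverse`, ★ `RCubeY` (3.25),
★ `CCubeY := XinvCubeY ∘ (diagonal cWtCubeY)♯` (3.48), ★ `deltaACubeY parS parB U := hessY i U + gradY i U ∘ RCubeY ∘ divY i U + QsCubeY ∘ aCubeY ∘ QCubeY`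
(3.26) on `FBondY i → 𝔸`, ★ `GACubeY parS parB : BondOpY 𝔸 i := fun U => Ring.inverse (deltaACubeY … U)` (3.27).  §4 at `U = 1`: the transporters
are `1`, `Q_□(1) ∕ Q*_□(1) ∕ Q′_□(1) ∕ Q′*_□(1)` are the lifts of the flat kernels, ★ `XCubeY_one` (`(Q′G′_□²Q′*)(1)` = the lift of
`qpKc·G′_□(1)·G′_□(1)·qpsKc` with `G′_□(1) = GpCubeW` from `B9CubeLettersOpsL0.GpCubeY_one`), the inverse laws `deltaACubeY_mul_GACubeY ∕
GACubeY_mul_deltaACubeY` where `Δ_{a,□}(U)` is a unit.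

## HONEST SCOPE

* Formulas only (lattice units, def-Y's conventions M1–M5 of `OpsYDeltaA` apply verbatim); NO inequality; the identification of `Δ_{a,□}(1)` with
  [4]'s typed `Δ_a` of the cube sequence (`B6SectAVectorModelV1.deltaAE (domCube i q)`) — hence `G_□(1) = GE (domCube i q) …` of
  `B9Thm33CubeAtOne` — and `XinvCubeY ∕ CCubeY` at `U = 1` = `B9Thm31CubeLocalFlat.CinvCubeW` (unit laws of `B9Ineq349CubeLocalFlat`) are the
  NEXT file; invertibility of `Δ_{a,□}(U)` for small fields is Thm 3.3's content, not claimed.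
* Nothing is inferred from the manuscript; kernel-checked.  NOT summit progress; the YM mass gap is not proved by any of this.
-/

namespace Literature.MathematicalPhysics.QuantumFieldTheory.Balaban1983to89.B9CubeLettersBondOpsL0

open LatticeFieldCalculus
open Node00
open Literature.MathematicalPhysics.QuantumFieldTheory.Balaban1983to89.B6KLevelCensusIndexV1 (KIdx)
open Literature.MathematicalPhysics.QuantumFieldTheory.Balaban1983to89.B6Prop22KLevelTorusCensusEta (nKT)
open Literature.MathematicalPhysics.QuantumFieldTheory.Balaban1983to89.B6Ineq2133TwoScaleV1 (onFun)
open Literature.MathematicalPhysics.QuantumFieldTheory.Balaban1983to89.B6SectAOperatorsV1 (BondIdx QE QsE aE)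
open Literature.MathematicalPhysics.QuantumFieldTheory.Balaban1983to89.B6GlobalChartV1 (PV)
open Literature.MathematicalPhysics.QuantumFieldTheory.Balaban1983to89.B6Cover236MultiLevelBlocks (cubes)
open Literature.MathematicalPhysics.QuantumFieldTheory.Balaban1983to89.B15DeterminingSets (embIter)
open Literature.MathematicalPhysics.QuantumFieldTheory.Balaban1983to89.B9CubeLettersOpsL0 (cubeFamY GpCubeY GpCubeY_one)
open Literature.MathematicalPhysics.QuantumFieldTheory.Balaban1983to89.B9CubeBondWeights (domCube wCubeBond)
open Literature.MathematicalPhysics.QuantumFieldTheory.Balaban1983to89.B9Thm31CubeLocalFlat (GpCubeW)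
open scoped Matrix

noncomputable section

variable {d ℓ : ℕ} {hd : 1 ≤ d + 1} {hL : Odd (ℓ + 1) ∧ 1 < ℓ + 1} {b₀ b₁ : ℝ}
variable {𝔸 : Type} [NormedRing 𝔸] [NormedAlgebra ℂ 𝔸] [CompleteSpace 𝔸]

/-! ## §1 Carriers of the cube sequence -/

/-- the BLOCKS of the cube sequence `{Ω_n(□)}` (unit cubes on its floor, `L^j`-blocks on `B^j(Λ_j(□))`). [cite: Balaban1985BackgroundPropagators, p.408, (3.87) p.409, dictionary] -/
abbrev BlkCubeY (i : KIdx d ℓ hd hL b₀ b₁) (q : ↥(cubes (toKT i).D.toDomains)) : Type :=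
  ↥(B6Geom246MultiLevelBoxL0.bset (cubeFamY i q).toDomains)

/-- the INDEX BONDS (2.3) of the cube sequence. [cite: Balaban1985BackgroundPropagators, p.408; Balaban1984PropagatorsII, (2.3) p.224, dictionary] -/
abbrev IBondCubeY (i : KIdx d ℓ hd hL b₀ b₁) (q : ↥(cubes (toKT i).D.toDomains)) : Type := BondIdx (domCube i q)

/-! ## §2 Flat kernels and transporter assignments -/

section Kernels

variable (i : KIdx d ℓ hd hL b₀ b₁) (q : ↥(cubes (toKT i).D.toDomains))

/-- the flat kernel of the cube sequence's bond averaging `Q`. [cite: Balaban1985BackgroundPropagators, (3.12)–(3.14) pp.392–393; Balaban1984PropagatorsII, (2.20) p.226] -/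
def qKc : Matrix (IBondCubeY i q) (FBondY i) ℝ := LinearMap.toMatrix' (onFun (QE (domCube i q)))

/-- the flat kernel of the cube sequence's `Q*`. [cite: Balaban1985BackgroundPropagators, (3.13) p.392; Balaban1984PropagatorsII, (2.19) p.226] -/
def qsKc : Matrix (FBondY i) (IBondCubeY i q) ℝ := LinearMap.toMatrix' (onFun (QsE (domCube i q)))

/-- the weight operator `a` of the cube sequence (weights `wCubeBond`). [cite: Balaban1985BackgroundPropagators, (3.26) p.395; Balaban1984PropagatorsII, (2.16) p.225] -/
def aKc : Matrix (IBondCubeY i q) (IBondCubeY i q) ℝ := LinearMap.toMatrix' (onFun (aE (domCube i q) (wCubeBond i q)))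

/-- the flat kernel of the cube sequence's block averaging `Q′`. [cite: Balaban1985BackgroundPropagators, (3.21) p.394; Balaban1984PropagatorsII, (2.14) p.225] -/
def qpKc : Matrix (BlkCubeY i q) (SiteY i) ℝ := B6Ineq288MultiLevelTorusL0.QM (cubeFamY i q)

/-- the flat kernel of the cube sequence's `Q′*`. [cite: Balaban1985BackgroundPropagators, (3.21) p.394; Balaban1984PropagatorsII, (2.69) p.235] -/
def qpsKc : Matrix (SiteY i) (BlkCubeY i q) ℝ := B6Ineq288MultiLevelTorusL0.QsM (cubeFamY i q)

/-- the block-sector reading weights `η^{−4−(d+1)}/(L^{j′})^{d+1}` on the cube sequence's blocks. [cite: Balaban1985BackgroundPropagators, (3.48) p.398; Balaban1984PropagatorsII, (2.69) p.235, dictionary] -/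
def cWtCubeY : BlkCubeY i q → ℝ := fun s => (((nKT (toKT i) : ℕ) : ℝ)) ^ (4 + (d + 1)) / B6Ineq268MultiLevelBoxL0.W (cubeFamY i q).toDomains s

/-- the corner site of a block of the cube sequence. [cite: Balaban1985BackgroundPropagators, (3.21) p.394, dictionary] -/
def blkCornerCubeY (s : BlkCubeY i q) : SiteY i :=
  ⟨B6Geom246MultiLevelBoxL0.corner (cubeFamY i q).toDomains s, B6Geom246MultiLevelBoxL0.corner_mem (cubeFamY i q).toDomains s⟩

/-- transporter assignment of `Q_□(U)`: def-Y's formula (transport to the initial point of the coarse bond along `parB`). [cite: Balaban1985BackgroundPropagators, (3.12)–(3.14) pp.392–393] -/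
def qTc (parB : BondParY 𝔸 i) (U : CfgY 𝔸 i) : IBondCubeY i q → FBondY i → 𝔸ˣ := fun ι b => parB U (embIter (ι.1.1 : ℕ) ι.1.2.src) b.src

/-- transporter assignment of `Q′_□(U)`: transport to the corner of the CUBE SEQUENCE's block along `parS`. [cite: Balaban1985BackgroundPropagators, (3.21) p.394] -/
def qpTc (parS : SiteParY 𝔸 i) (U : CfgY 𝔸 i) : BlkCubeY i q → SiteY i → 𝔸ˣ := fun s z => parS U (blkCornerCubeY i q s) z

end Kernels

/-! ## §3 The letters -/

section Letters

variable (i : KIdx d ℓ hd hL b₀ b₁) (q : ↥(cubes (toKT i).D.toDomains))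

/-- `Q_□(U)`. [cite: Balaban1985BackgroundPropagators, (3.12)–(3.14) pp.392–393, p.409] -/
def QCubeY (parB : BondParY 𝔸 i) (U : CfgY 𝔸 i) : (FBondY i → 𝔸) →ₗ[ℂ] (IBondCubeY i q → 𝔸) := trLiftY (qKc i q) (qTc i q parB U)

/-- `Q*_□(U)`. [cite: Balaban1985BackgroundPropagators, (3.13) p.392, p.409] -/
def QsCubeY (parB : BondParY 𝔸 i) (U : CfgY 𝔸 i) : (IBondCubeY i q → 𝔸) →ₗ[ℂ] (FBondY i → 𝔸) :=
  trLiftY (qsKc i q) fun b ι => (qTc i q parB U ι b)⁻¹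

/-- `a_□`. [cite: Balaban1985BackgroundPropagators, (3.26) p.395, p.409] -/
def aCubeY : (IBondCubeY i q → 𝔸) →ₗ[ℂ] (IBondCubeY i q → 𝔸) := liftMatY 𝔸 (aKc i q)

/-- `Q′_□(U)`. [cite: Balaban1985BackgroundPropagators, (3.21) p.394, p.409] -/
def QpCubeY (parS : SiteParY 𝔸 i) (U : CfgY 𝔸 i) : (SiteY i → 𝔸) →ₗ[ℂ] (BlkCubeY i q → 𝔸) := trLiftY (qpKc i q) (qpTc i q parS U)

/-- `Q′*_□(U)`. [cite: Balaban1985BackgroundPropagators, (3.21) p.394, p.409] -/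
def QpsCubeY (parS : SiteParY 𝔸 i) (U : CfgY 𝔸 i) : (BlkCubeY i q → 𝔸) →ₗ[ℂ] (SiteY i → 𝔸) :=
  trLiftY (qpsKc i q) fun z s => (qpTc i q parS U s z)⁻¹

/-- ★ `(Q′G′_□²Q′*)(U)` on the cube sequence's block functions. [cite: Balaban1985BackgroundPropagators, (3.25) p.394, p.409] -/
def XCubeY (parS : SiteParY 𝔸 i) (U : CfgY 𝔸 i) : (BlkCubeY i q → 𝔸) →ₗ[ℂ] (BlkCubeY i q → 𝔸) :=
  QpCubeY i q parS U ∘ₗ GpCubeY i q parS U ∘ₗ GpCubeY i q parS U ∘ₗ QpsCubeY i q parS U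

/-- `(Q′G′_□²Q′*)⁻¹(U)` (`Ring.inverse`). [cite: Balaban1985BackgroundPropagators, (3.25) p.394, p.409] -/
def XinvCubeY (parS : SiteParY 𝔸 i) (U : CfgY 𝔸 i) : (BlkCubeY i q → 𝔸) →ₗ[ℂ] (BlkCubeY i q → 𝔸) := Ring.inverse (XCubeY i q parS U)

/-- ★ `R_□(U) = I − G′_□Q′*_□(Q′G′_□²Q′*)⁻¹Q′_□G′_□ (U)` — (3.25) for the cube sequence. [cite: Balaban1985BackgroundPropagators, (3.25) p.394, p.409] -/
def RCubeY (parS : SiteParY 𝔸 i) (U : CfgY 𝔸 i) : (SiteY i → 𝔸) →ₗ[ℂ] (SiteY i → 𝔸) :=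
  LinearMap.id - GpCubeY i q parS U ∘ₗ QpsCubeY i q parS U ∘ₗ XinvCubeY i q parS U ∘ₗ QpCubeY i q parS U ∘ₗ GpCubeY i q parS U

/-- ★ **THE LETTER `C_□(U) = (Q′(U)G′_□²(U)Q′*(U))⁻¹`** read against the block pairing (def-Y's `CY` verbatim over the cube sequence's blocks).
[cite: Balaban1985BackgroundPropagators, p.409 l.1–5, (3.48) p.398, (3.87) p.409] -/
def CCubeY (parS : SiteParY 𝔸 i) (U : CfgY 𝔸 i) : (BlkCubeY i q → 𝔸) →ₗ[ℂ] (BlkCubeY i q → 𝔸) :=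
  XinvCubeY i q parS U ∘ₗ liftMatY 𝔸 (Matrix.diagonal (cWtCubeY i q))

/-- ★ **`Δ_{a,□}(U) = Δ(U) + D_U R_□(U) D*_U + Q*_□(U) a_□ Q_□(U)`** — (3.26) for the cube sequence, on the member's fine bonds.
[cite: Balaban1985BackgroundPropagators, (3.26) p.395, p.409 l.1–5] -/
def deltaACubeY (parS : SiteParY 𝔸 i) (parB : BondParY 𝔸 i) (U : CfgY 𝔸 i) : (FBondY i → 𝔸) →ₗ[ℂ] (FBondY i → 𝔸) :=
  hessY i U + gradY i U ∘ₗ RCubeY i q parS U ∘ₗ divY i U + QsCubeY i q parB U ∘ₗ aCubeY i q ∘ₗ QCubeY i q parB U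

/-- ★ **`G_□(U) = Δ_{a,□}(U)⁻¹`** — (3.27) for the cube sequence (`Ring.inverse`: the genuine inverse where `Δ_{a,□}(U)` is invertible, `0` elsewhere).
[cite: Balaban1985BackgroundPropagators, (3.27) p.395, p.409 l.1–5, (3.87) p.409] -/
def GACubeY (parS : SiteParY 𝔸 i) (parB : BondParY 𝔸 i) : BondOpY 𝔸 i := fun U => Ring.inverse (deltaACubeY i q parS parB U)

/-- `Δ_{a,□}(U)·G_□(U) = 1` wherever `Δ_{a,□}(U)` is invertible. [cite: Balaban1985BackgroundPropagators, (3.27) p.395] -/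
theorem deltaACubeY_mul_GACubeY {parS : SiteParY 𝔸 i} {parB : BondParY 𝔸 i} {U : CfgY 𝔸 i}
    (hU : IsUnit (deltaACubeY i q parS parB U)) : deltaACubeY i q parS parB U * GACubeY i q parS parB U = 1 :=
  Ring.mul_inverse_cancel _ hU

/-- `G_□(U)·Δ_{a,□}(U) = 1` wherever `Δ_{a,□}(U)` is invertible. [cite: Balaban1985BackgroundPropagators, (3.27) p.395] -/
theorem GACubeY_mul_deltaACubeY {parS : SiteParY 𝔸 i} {parB : BondParY 𝔸 i} {U : CfgY 𝔸 i}
    (hU : IsUnit (deltaACubeY i q parS parB U)) : GACubeY i q parS parB U * deltaACubeY i q parS parB U = 1 :=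
  Ring.inverse_mul_cancel _ hU

/-- `(Q′G′_□²Q′*)(U)·(Q′G′_□²Q′*)⁻¹(U) = 1` wherever the former is invertible. [cite: Balaban1985BackgroundPropagators, (3.25) p.394] -/
theorem XCubeY_mul_XinvCubeY {parS : SiteParY 𝔸 i} {U : CfgY 𝔸 i} (hU : IsUnit (XCubeY i q parS U)) :
    XCubeY i q parS U * XinvCubeY i q parS U = 1 :=
  Ring.mul_inverse_cancel _ hU

end Letters

/-! ## §4 At `U = 1` -/

section AtOne

variable (i : KIdx d ℓ hd hL b₀ b₁) (q : ↥(cubes (toKT i).D.toDomains))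

/-- at `U = 1` the averaging transporters are `1`. [cite: Balaban1985BackgroundPropagators, p.395, bookkeeping] -/
theorem qTc_one {parB : BondParY 𝔸 i} (hparB : ∀ s s', parB (fun _ _ => 1) s s' = 1) (ι : IBondCubeY i q) (b : FBondY i) :
    qTc i q parB (fun _ _ => 1) ι b = 1 := hparB _ _

/-- at `U = 1` the block-averaging transporters are `1`. [cite: Balaban1985BackgroundPropagators, p.395, bookkeeping] -/
theorem qpTc_one {parS : SiteParY 𝔸 i} (hparS : ∀ z w, parS (fun _ _ => 1) z w = 1) (s : BlkCubeY i q) (z : SiteY i) :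
    qpTc i q parS (fun _ _ => 1) s z = 1 := hparS _ _

/-- `Q_□(1) = Q♯`. [cite: Balaban1985BackgroundPropagators, p.395, Cor. 3.5 p.407] -/
theorem QCubeY_one {parB : BondParY 𝔸 i} (hparB : ∀ s s', parB (fun _ _ => 1) s s' = 1) :
    QCubeY i q parB (fun _ _ => 1) = liftMatY 𝔸 (qKc i q) :=
  trLiftY_eq_liftMatY_of_one 𝔸 (qTc_one i q hparB)

/-- `Q*_□(1) = Q*♯`. [cite: Balaban1985BackgroundPropagators, p.395, Cor. 3.5 p.407] -/
theorem QsCubeY_one {parB : BondParY 𝔸 i} (hparB : ∀ s s', parB (fun _ _ => 1) s s' = 1) :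
    QsCubeY i q parB (fun _ _ => 1) = liftMatY 𝔸 (qsKc i q) :=
  trLiftY_eq_liftMatY_of_one 𝔸 fun b ι => by rw [qTc_one i q hparB, inv_one]

/-- `Q′_□(1) = Q′♯`. [cite: Balaban1985BackgroundPropagators, p.395, Cor. 3.5 p.407] -/
theorem QpCubeY_one {parS : SiteParY 𝔸 i} (hparS : ∀ z w, parS (fun _ _ => 1) z w = 1) :
    QpCubeY i q parS (fun _ _ => 1) = liftMatY 𝔸 (qpKc i q) :=
  trLiftY_eq_liftMatY_of_one 𝔸 (qpTc_one i q hparS)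

/-- `Q′*_□(1) = Q′*♯`. [cite: Balaban1985BackgroundPropagators, p.395, Cor. 3.5 p.407] -/
theorem QpsCubeY_one {parS : SiteParY 𝔸 i} (hparS : ∀ z w, parS (fun _ _ => 1) z w = 1) :
    QpsCubeY i q parS (fun _ _ => 1) = liftMatY 𝔸 (qpsKc i q) :=
  trLiftY_eq_liftMatY_of_one 𝔸 fun z s => by rw [qpTc_one i q hparS, inv_one]

/-- ★ **`(Q′G′_□²Q′*)(1)` IS THE LIFT OF THE FLAT PRODUCT `Q′♯·G′_□(1)·G′_□(1)·Q′*♯`** with `G′_□(1) = GpCubeW` (`B9CubeLettersOpsL0.GpCubeY_one`).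
[cite: Balaban1985BackgroundPropagators, (3.25) p.394, Cor. 3.5 p.407, p.409] -/
theorem XCubeY_one {parS : SiteParY 𝔸 i} (hparS : ∀ z w, parS (fun _ _ => 1) z w = 1) :
    XCubeY i q parS (fun _ _ => 1) =
      liftMatY 𝔸 (qpKc i q * GpCubeW (toKT i).D q hL.1 (B9CubeLettersOpsL0.oddMh i) (toKT i).hMh (toKT i).hP *
        GpCubeW (toKT i).D q hL.1 (B9CubeLettersOpsL0.oddMh i) (toKT i).hMh (toKT i).hP * qpsKc i q) := by
  rw [XCubeY, QpCubeY_one i q hparS, QpsCubeY_one i q hparS, GpCubeY_one i q parS hparS, liftOpY_eq_liftMatY, ← liftMatY_mul, ← liftMatY_mul,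
    ← liftMatY_mul]
  simp only [Matrix.mul_assoc]

end AtOne

end

end Literature.MathematicalPhysics.QuantumFieldTheory.Balaban1983to89.B9CubeLettersBondOpsL0
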